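import Mathlib
import Summits.Ventures.PercRepro2.TB14NoDepInv

/-!
# Row 2′TB: the SELF-CONSISTENCY PRINCIPLE — a flip set whose star flip reproduces it injects
(blind cell PercRepro2, mine-c g24, 2026-08-26; `conjectures/MINE-C.md` §33.0 (i))

All-free profile.  A vertex set `Z` is SELF-CONSISTENT for a source `y` when the star flip of `Z`
is a target whose `o`-component of the arms (`oArm`) is `Z` again.  Then the source is recovered
from its image by the star flip of the image's own `oArm`, so ANY choice of self-consistent sets,
one per source, is an injection of the sources into the targets — no collision analysis:
* `selfConsistent_recover`: `y = starFlip (oArm (starFlip Z y)) (starFlip Z y)`;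
* `card_filter_srcSet_le_of_selfConsistent`: on any slice `P` of the sources closed under the
  chosen flips, `#(sources ∩ P) ≤ #(targets ∩ P)`;
* `card_srcSet_le_of_selfConsistent`: with `P = ⊤`, the whole row `#Src ≤ #Tgt` follows from a
  self-consistent choice on every source;
* `selfConsistent_oArm_of_noDep`: on the NoDep slice `Z = oArm` is self-consistent
  (`isTgt_starFlip_oArm`, `oArm_starFlip`), so `card_ndSrc_le_card_ndTgt'` re-derives the NoDep
  theorem of `TB14NoDepInv` as an instance of the principle.
Census (MINE-C.md §33.0 (i)): every NoDep source has a self-consistent set, a dependent-core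
source has none on 5 vertices and rarely on 6 — the principle is exactly the NoDep slice plus a
thin layer.  Own work; standard axioms.
-/

namespace Summit.Ventures.PercRepro2

namespace TB14SelfConsistent

open CovForm A3InactiveTyped TB14FlipFamily TB14Hall TB14NoDep TB14NoDepInv

section Defs

variable {V : Type} {E : Type} [DecidableEq E] [Fintype V]
variable (ends : E → Sym2 V) (a₁ a₂ b o : V) (F : Finset E)

/-- `Z` is a SELF-CONSISTENT flip set of `y`: the star flip of `Z` is a target whose `o`-component
of the arms is `Z` itself. -/
def SelfConsistent (Z : Finset V) (y : Config E) : Prop :=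
  IsTgt ends a₁ a₂ b o F (starFlip ends Z y) ∧ oArm ends a₂ o F (starFlip ends Z y) = Z

/-- The source is recovered from the image of a self-consistent flip by the star flip of the
image's own `oArm`. -/
lemma selfConsistent_recover {Z : Finset V} {y : Config E}
    (h : SelfConsistent ends a₁ a₂ b o F Z y) :
    starFlip ends (oArm ends a₂ o F (starFlip ends Z y)) (starFlip ends Z y) = y := by
  rw [h.2]
  exact starFlip_starFlip ends Z y

end Defs

section Count

variable {V : Type} {E : Type} [Fintype E] [DecidableEq E] [Fintype V]
variable (ends : E → Sym2 V) (a₁ a₂ b o : V)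

/-- **THE SELF-CONSISTENCY PRINCIPLE on a slice**: if every source of the slice `P` has a
self-consistent flip set whose image stays in `P`, the sources of the slice inject into the
targets of the slice (all-free profile, every finite multigraph). -/
theorem card_filter_srcSet_le_of_selfConsistent (P : Config E → Prop) [DecidablePred P]
    (Z : Config E → Finset V)
    (hZ : ∀ y, IsSrc ends a₁ a₂ b o Finset.univ y → P y →
      SelfConsistent ends a₁ a₂ b o Finset.univ (Z y) y ∧ P (starFlip ends (Z y) y)) :
    ((srcSet ends a₁ a₂ b o Finset.univ (fun _ => false)).filter P).card ≤
      ((tgtSet ends a₁ a₂ b o Finset.univ (fun _ => false)).filter P).card := by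
  classical
  have hF : ∀ e, e ∈ (Finset.univ : Finset E) := fun e => Finset.mem_univ e
  have hsrc : ∀ y ∈ (srcSet ends a₁ a₂ b o Finset.univ (fun _ => false)).filter P,
      IsSrc ends a₁ a₂ b o Finset.univ y ∧ P y := by
    intro y hy
    rw [Finset.mem_filter] at hy
    unfold srcSet at hy
    rw [Finset.mem_filter] at hy
    exact ⟨hy.1.2.2, hy.2⟩
  refine Finset.card_le_card_of_injOn (fun y => starFlip ends (Z y) y) ?_ ?_
  · intro y hy
    rw [Finset.mem_coe] at hy
    obtain ⟨hs, hP⟩ := hsrc y hy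
    obtain ⟨hsc, hP'⟩ := hZ y hs hP
    rw [Finset.mem_coe]
    show starFlip ends (Z y) y ∈ (tgtSet ends a₁ a₂ b o Finset.univ (fun _ => false)).filter P
    rw [Finset.mem_filter]
    refine ⟨?_, hP'⟩
    unfold tgtSet
    rw [Finset.mem_filter]
    exact ⟨Finset.mem_univ _, fun e he => absurd (hF e) he, hsc.1⟩
  · intro y₁ hy₁ y₂ hy₂ heq
    rw [Finset.mem_coe] at hy₁ hy₂
    obtain ⟨hs₁, hP₁⟩ := hsrc y₁ hy₁
    obtain ⟨hs₂, hP₂⟩ := hsrc y₂ hy₂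
    obtain ⟨hsc₁, -⟩ := hZ y₁ hs₁ hP₁
    obtain ⟨hsc₂, -⟩ := hZ y₂ hs₂ hP₂
    simp only at heq
    calc y₁ = starFlip ends (oArm ends a₂ o Finset.univ (starFlip ends (Z y₁) y₁))
            (starFlip ends (Z y₁) y₁) :=
          (selfConsistent_recover ends a₁ a₂ b o Finset.univ hsc₁).symm
      _ = starFlip ends (oArm ends a₂ o Finset.univ (starFlip ends (Z y₂) y₂))
            (starFlip ends (Z y₂) y₂) := by rw [heq]
      _ = y₂ := selfConsistent_recover ends a₁ a₂ b o Finset.univ hsc₂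

/-- **THE SELF-CONSISTENCY PRINCIPLE**: a self-consistent flip set on every source gives the
row, `#Src ≤ #Tgt`, at the all-free profile of every finite multigraph. -/
theorem card_srcSet_le_of_selfConsistent (Z : Config E → Finset V)
    (hZ : ∀ y, IsSrc ends a₁ a₂ b o Finset.univ y →
      SelfConsistent ends a₁ a₂ b o Finset.univ (Z y) y) :
    (srcSet ends a₁ a₂ b o Finset.univ (fun _ => false)).card ≤
      (tgtSet ends a₁ a₂ b o Finset.univ (fun _ => false)).card := by
  classical
  have h := card_filter_srcSet_le_of_selfConsistent ends a₁ a₂ b o (fun _ => True) Z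
    (fun y hs _ => ⟨hZ y hs, trivial⟩)
  rw [Finset.filter_true, Finset.filter_true] at h
  exact h

/-- On the NoDep slice, `o`'s component of the arms is a self-consistent flip set
(`isTgt_starFlip_oArm` + `oArm_starFlip`). -/
lemma selfConsistent_oArm_of_noDep {y : Config E}
    (hs : IsSrc ends a₁ a₂ b o Finset.univ y) (hnd : NoDep ends a₂ o Finset.univ y) :
    SelfConsistent ends a₁ a₂ b o Finset.univ (oArm ends a₂ o Finset.univ y) y := by
  have hF : ∀ e, e ∈ (Finset.univ : Finset E) := fun e => Finset.mem_univ e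
  exact ⟨isTgt_starFlip_oArm ends a₁ a₂ b o Finset.univ hF hs,
    oArm_starFlip ends a₁ a₂ b o Finset.univ hF hs hnd⟩

/-- The NoDep theorem (`TB14NoDepInv.card_ndSrc_le_card_ndTgt`) as an instance of the
self-consistency principle: the slice `P = NoDep`, the flip set `Z = oArm`. -/
theorem card_ndSrc_le_card_ndTgt' :
    (ndSrc ends a₁ a₂ b o).card ≤ (ndTgt ends a₁ a₂ b o).card := by
  classical
  have hF : ∀ e, e ∈ (Finset.univ : Finset E) := fun e => Finset.mem_univ e
  exact card_filter_srcSet_le_of_selfConsistent ends a₁ a₂ b o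
    (fun y => NoDep ends a₂ o Finset.univ y) (fun y => oArm ends a₂ o Finset.univ y)
    (fun y hs hnd => ⟨selfConsistent_oArm_of_noDep ends a₁ a₂ b o hs hnd,
      noDep_starFlip ends a₁ a₂ b o Finset.univ hF hs hnd⟩)

end Count

end TB14SelfConsistent

end Summit.Ventures.PercRepro2
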